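/-
Copyright: public-domain mathematics; typed transcription for the H21 Literature library (cell lit-balaban,
reader/typer seat r02 gen 5 = literature-prover-lit-balaban-r02-g5-0).

statement-level skeleton of published theorems with citation tags; proofs where landed; nothing here is a claim about the Yang–Mills mass gap

# Bałaban, *Propagators and renormalization transformations for lattice gauge theories. I*,
# Commun. Math. Phys. **95** (1984) 17–40 — balls of the unit lattice `T₁^{(k)}` have at most `(2r+1)^d` points
# (the field `nbr_card` of the (1.132)/(1.133) carriers: finitely many neighbours, uniformly in the torus)

[cite: Balaban1984PropagatorsI]  T. Bałaban, Commun. Math. Phys. 95 (1984) 17–40.  p. 35 (the unit lattice T₁^{(k)} and its cubes);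
p. 39 (1.132)–(1.133) (sums over neighbouring cubes).

WHAT THIS MODULE ADDS (SKELETON row B5.Prop1.2 census (vii)): on `Tor M` with `distSite` of `B5Prop12FieldsLattice`,
`ball M y r := {w | distSite y w ≤ r}` and **`card_ball_le : #ball ≤ (2r+1)^d`** (injection `w ↦ (valMinAbs (w_μ − y_μ) + r)_μ` into
`Fin d → Fin (2r+1)`), i.e. the `nbr_card` field of `B5Transfer132.MapFacts` / `B5Transfer133.CarrierFacts` with `Nn = (2r₀+1)^d`
uniformly in the torus.

HONEST SCOPE.  Elementary; nothing analytic.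
-/
import Mathlib
import Literature.MathematicalPhysics.QuantumFieldTheory.Balaban1983to89.B5Prop12FieldsLattice

open scoped BigOperators
open Finset

namespace Literature.MathematicalPhysics.QuantumFieldTheory.Balaban1983to89.B5UnitBallCard

open Literature.MathematicalPhysics.QuantumFieldTheory.Balaban1983to89
open Literature.MathematicalPhysics.QuantumFieldTheory.Balaban1983to89.B5Prop11Plancherel (Tor)
open Literature.MathematicalPhysics.QuantumFieldTheory.Balaban1983to89.B5Prop12FieldsLattice (distSite)

noncomputable section

variable {d : ℕ} (M : Fin d → ℕ) [hM : ∀ μ, NeZero (M μ)]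

/-! ## Balls of `T₁^{(k)}` and their cardinality -/

/-- the ball of radius `r` of the unit lattice around `y` (sup torus distance). [cite: Balaban1984PropagatorsI, p.35, (1.133) p.39] -/
def ball (y : Tor M) (r : ℕ) : Finset (Tor M) := Finset.univ.filter fun w => distSite M y w ≤ r

/-- membership. [cite: Balaban1984PropagatorsI, p.35] -/
theorem mem_ball (y w : Tor M) (r : ℕ) : w ∈ ball M y r ↔ distSite M y w ≤ r := by
  simp [ball]

/-- in a ball every coordinate's centred representative is at most `r`. [cite: Balaban1984PropagatorsI, p.35] -/
theorem natAbs_le_of_mem_ball {y w : Tor M} {r : ℕ} (h : w ∈ ball M y r) (μ : Fin d) : ((y μ - w μ).valMinAbs).natAbs ≤ r := by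
  rw [mem_ball] at h
  unfold distSite at h
  have h' : (Finset.univ.sup fun μ => ((y μ - w μ).valMinAbs).natAbs) ≤ r := by exact_mod_cast h
  exact (Finset.le_sup (f := fun μ => ((y μ - w μ).valMinAbs).natAbs) (Finset.mem_univ μ)).trans h'

/-- the coordinates of the injection: `valMinAbs (y_μ − w_μ) + r ∈ [0, 2r]`. [cite: Balaban1984PropagatorsI, p.35] -/
def code (y : Tor M) (r : ℕ) (w : Tor M) : Fin d → Fin (2 * r + 1) := fun μ =>
  ⟨min (((y μ - w μ).valMinAbs + r).toNat) (2 * r), by omega⟩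

/-- on the ball the truncation in `code` is inactive. [cite: Balaban1984PropagatorsI, p.35] -/
theorem code_val_of_mem_ball {y w : Tor M} {r : ℕ} (h : w ∈ ball M y r) (μ : Fin d) :
    ((code M y r w μ : ℕ) : ℤ) = (y μ - w μ).valMinAbs + r := by
  have hb := natAbs_le_of_mem_ball M h μ
  have h1 : -(r : ℤ) ≤ (y μ - w μ).valMinAbs ∧ (y μ - w μ).valMinAbs ≤ r := by
    constructor <;> omega
  have h2 : 0 ≤ (y μ - w μ).valMinAbs + r := by omega
  have h3 : ((y μ - w μ).valMinAbs + r).toNat ≤ 2 * r := by omega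
  show ((min (((y μ - w μ).valMinAbs + r).toNat) (2 * r) : ℕ) : ℤ) = _
  rw [min_eq_left h3, Int.toNat_of_nonneg h2]

/-- `code` is injective on the ball. [cite: Balaban1984PropagatorsI, p.35] -/
theorem code_injOn (y : Tor M) (r : ℕ) : Set.InjOn (code M y r) (ball M y r : Set (Tor M)) := by
  intro w hw w' hw' h
  funext μ
  have e : ((code M y r w μ : ℕ) : ℤ) = ((code M y r w' μ : ℕ) : ℤ) := by rw [h]
  rw [code_val_of_mem_ball M hw μ, code_val_of_mem_ball M hw' μ] at e
  have e' : (y μ - w μ).valMinAbs = (y μ - w' μ).valMinAbs := by omega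
  have e'' : y μ - w μ = y μ - w' μ := by
    rw [← ZMod.coe_valMinAbs (y μ - w μ), ← ZMod.coe_valMinAbs (y μ - w' μ), e']
  exact sub_right_injective e''

/-- **`#ball(y, r) ≤ (2r+1)^d`, uniformly in the torus** — the `nbr_card` field of the (1.132)/(1.133) carriers.
[cite: Balaban1984PropagatorsI, p.35 (T₁^{(k)}), (1.133) p.39] -/
theorem card_ball_le (y : Tor M) (r : ℕ) : (ball M y r).card ≤ (2 * r + 1) ^ d := by
  calc (ball M y r).card = ((ball M y r).image (code M y r)).card := (Finset.card_image_of_injOn (code_injOn M y r)).symm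
    _ ≤ (Finset.univ : Finset (Fin d → Fin (2 * r + 1))).card := Finset.card_le_card (Finset.subset_univ _)
    _ = (2 * r + 1) ^ d := by simp

/-- real-valued form for the records (`((nbr y).card : ℝ) ≤ Nn`). [cite: Balaban1984PropagatorsI, (1.133) p.39] -/
theorem card_ball_le_real (y : Tor M) (r : ℕ) : ((ball M y r).card : ℝ) ≤ ((2 * r + 1 : ℕ) : ℝ) ^ d := by
  exact_mod_cast card_ball_le M y r

/-- `nbr_dist`: members of the ball are within `r`. [cite: Balaban1984PropagatorsI, (1.133) p.39] -/
theorem dist_le_of_mem_ball {y w : Tor M} {r : ℕ} (h : w ∈ ball M y r) : distSite M y w ≤ r := (mem_ball M y w r).mp h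

end

end Literature.MathematicalPhysics.QuantumFieldTheory.Balaban1983to89.B5UnitBallCard
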